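import Summits.CriticalPhenomena.PercolationContinuityZ3.Theorems.SahiTP2Positivity
import Summits.CriticalPhenomena.PercolationContinuityZ3.Theorems.SahiTwoDimSemicontinuous
import Mathlib.MeasureTheory.Integral.Indicator

/-!
# Cell-FKG measures on the unit square are TP₂ across cuts: Sahi positivity of every order for every cell-FKG law,
# all measurable monotone families (the semicontinuity hypothesis of generation 6 removed)

Companion of `SahiTP2Kernel.lean` / `SahiTP2Positivity.lean` (cell `prim-sahi`, typer seat, generation 10;
`--supports stmt-CriticalPhenomena-4575`).

`SahiTwoDimSemicontinuous.msahiE_nonneg_of_semicontinuous` (generation 6) proved Sahi's inequalities of every order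
for every probability measure `μ` on `[0,1]²` whose CELL WEIGHTS `w_m(c) = μ(cell c)` satisfy the FKG lattice condition
on every `(m+1) × (m+1)` grid ("cell-FKG"), for monotone families each lower or upper semicontinuous.  Here the
semicontinuity hypothesis is removed:

* `sum_mul_sum_le_of_latticeCondition` — AGGREGATION: a log-supermodular weight on a product of two chains has
  TP₂ block sums, `W(J₁ × K₂) W(J₂ × K₁) ≤ W(J₁ × K₁) W(J₂ × K₂)` for index blocks `J₁ ≤ J₂`, `K₁ ≤ K₂` (termwise the
  lattice condition);
* `isTP2Cut_of_isFKGMeasure_cellWeight` — LIMIT: approximating `[a₁,b₁] × L`, … by unions of cells of the `m`-th grid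
  (pointwise convergence of the indicators, `tendsto_measure_of_tendsto_indicator`; a lower set `L ⊆ [0,1]` is
  `[0,c]` or `[0,c)`, approximated by the cells of index `≤` resp. `<` that of `c`), every cell-FKG probability
  measure is TP₂ across cuts (`SahiTP2.IsTP2Cut`);
* `msahiE_nonneg_of_isFKGMeasure_cellWeight` (+ `_antitone`) — hence, by `msahiE_nonneg_of_isTP2Cut_unitSquare`:
  **every cell-FKG probability measure on `[0,1]²` is Sahi-positive of every order for ALL measurable nonnegative
  monotone families** (increasing or decreasing), with no absolute continuity, no semicontinuity.

Remark.  `IsTP2Cut` is strictly weaker than cell-FKG (it only compares a block of columns BELOW a cut with the block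
ABOVE it: e.g. a piecewise-uniform law with cell matrix `((1,2,1),(1,1,2),(1,1,2))/12` is TP₂ across cuts but not
cell-FKG), and by `SahiTP2Kernel.exists_cisKernel` together with the elementary converse it is equivalent to the law
being conditionally increasing; so the generation-10 theorem is the definitive two-dimensional statement for CIS laws
given intrinsically.

No sorries, no new axioms.  [cite: LiebSahi2021, Thm. 3.7] (the Lebesgue case behind everything).
-/

noncomputable section

namespace Summit.CriticalPhenomena.PercolationContinuityZ3.Theorems.SahiTP2

open MeasureTheory Set Filter Topology Function
open Literature.Combinatorics.Sahi2008 Literature.Combinatorics.Sahi2008.LebesgueSquare SahiTwoDimDensity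
  SahiTwoDimSemicontinuous
open scoped ENNReal unitInterval

/-! ## Aggregation: block sums of a log-supermodular weight on a product of chains are TP₂ -/

/-- **Aggregation lemma.** For a weight `w ≥ 0` on a product of two chains satisfying the FKG lattice condition
`w(p) w(q) ≤ w(p ⊓ q) w(p ⊔ q)` and index blocks `J₁ ≤ J₂`, `K₁ ≤ K₂` (elementwise),
`W(J₁ × K₂) · W(J₂ × K₁) ≤ W(J₁ × K₁) · W(J₂ × K₂)` — termwise the lattice condition at `p = (i,j')`, `q = (i',j)`.
[folklore] -/
theorem sum_mul_sum_le_of_latticeCondition {α β : Type*} [LinearOrder α] [LinearOrder β] (w : α × β → ℝ≥0∞)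
    (hw : ∀ p q, w p * w q ≤ w (p ⊓ q) * w (p ⊔ q)) (J₁ J₂ : Finset α) (K₁ K₂ : Finset β)
    (hJ : ∀ i ∈ J₁, ∀ i' ∈ J₂, i ≤ i') (hK : ∀ j ∈ K₁, ∀ j' ∈ K₂, j ≤ j') :
    (∑ p ∈ J₁ ×ˢ K₂, w p) * (∑ q ∈ J₂ ×ˢ K₁, w q) ≤ (∑ p ∈ J₁ ×ˢ K₁, w p) * (∑ q ∈ J₂ ×ˢ K₂, w q) := by
  rw [Finset.sum_product, Finset.sum_product, Finset.sum_product, Finset.sum_product, Finset.sum_mul_sum,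
    Finset.sum_mul_sum]
  refine Finset.sum_le_sum fun i hi => Finset.sum_le_sum fun i' hi' => ?_
  rw [Finset.sum_mul_sum, Finset.sum_mul_sum]
  conv_lhs => rw [Finset.sum_comm]
  refine Finset.sum_le_sum fun j hj => Finset.sum_le_sum fun j' hj' => ?_
  have h := hw (i, j') (i', j)
  rwa [Prod.mk_inf_mk, Prod.mk_sup_mk, inf_of_le_left (hJ i hi i' hi'), sup_of_le_right (hJ i hi i' hi'),
    inf_of_le_right (hK j hj j' hj'), sup_of_le_left (hK j hj j' hj')] at h

variable {m : ℕ}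

/-- Membership in a block of cells `cellPair m ⁻¹' (J × K)` (first index in `J`, second in `K`). [this work] -/
theorem mem_cellBlock {J K : Finset (Fin (m + 1))} {p : I × I} :
    p ∈ cellPair m ⁻¹' ↑(J ×ˢ K) ↔ cellIdx m p.1 ∈ J ∧ cellIdx m p.2 ∈ K := by
  simp only [mem_preimage, Finset.coe_product, mem_prod, Finset.mem_coe]
  rfl

/-- Blocks of cells are measurable. [this work] -/
theorem measurableSet_cellBlock (J K : Finset (Fin (m + 1))) : MeasurableSet (cellPair m ⁻¹' ↑(J ×ˢ K)) :=
  (cellPair_measurable m) (J ×ˢ K).measurableSet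

/-- The mass of a block of cells is the sum of the cell masses. [this work] -/
theorem measure_cellBlock (μ : Measure (I × I)) (J K : Finset (Fin (m + 1))) :
    μ (cellPair m ⁻¹' ↑(J ×ˢ K)) = ∑ c ∈ J ×ˢ K, μ (cellPair m ⁻¹' {c}) := by
  rw [← sum_measure_preimage_singleton _ fun c _ => (cellPair_measurable m) (measurableSet_singleton c)]

/-- **The level-`m` inequality**: if the cell weights of the `(m+1) × (m+1)` grid satisfy the FKG lattice condition,
then for index blocks `J₁ ≤ J₂`, `K₁ ≤ K₂`,
`μ(block J₁ × K₂) μ(block J₂ × K₁) ≤ μ(block J₁ × K₁) μ(block J₂ × K₂)`. [this work] -/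
theorem measure_cellBlock_mul_le (μ : Measure (I × I)) [IsFiniteMeasure μ] (hw : IsFKGMeasure (cellWeight μ m))
    (J₁ J₂ K₁ K₂ : Finset (Fin (m + 1))) (hJ : ∀ i ∈ J₁, ∀ i' ∈ J₂, i ≤ i') (hK : ∀ j ∈ K₁, ∀ j' ∈ K₂, j ≤ j') :
    μ (cellPair m ⁻¹' ↑(J₁ ×ˢ K₂)) * μ (cellPair m ⁻¹' ↑(J₂ ×ˢ K₁)) ≤
      μ (cellPair m ⁻¹' ↑(J₁ ×ˢ K₁)) * μ (cellPair m ⁻¹' ↑(J₂ ×ˢ K₂)) := by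
  simp only [measure_cellBlock]
  refine sum_mul_sum_le_of_latticeCondition (fun c => μ (cellPair m ⁻¹' {c})) (fun p q => ?_) J₁ J₂ K₁ K₂ hJ hK
  have h := hw.mul_le_mul p q
  simp only [cellWeight] at h
  rw [← ofReal_measureReal (μ := μ) (s := cellPair m ⁻¹' {p}), ← ofReal_measureReal (μ := μ) (s := cellPair m ⁻¹' {q}),
    ← ofReal_measureReal (μ := μ) (s := cellPair m ⁻¹' {p ⊓ q}),
    ← ofReal_measureReal (μ := μ) (s := cellPair m ⁻¹' {p ⊔ q}), ← ENNReal.ofReal_mul measureReal_nonneg,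
    ← ENNReal.ofReal_mul measureReal_nonneg]
  exact ENNReal.ofReal_le_ofReal h

/-! ## Pointwise convergence of the cell approximations -/

/-- The cell index is monotone. [folklore] -/
theorem cellIdx_le_cellIdx {x y : I} (h : x ≤ y) : cellIdx m x ≤ cellIdx m y :=
  (cellPair_mono m (show ((x, x) : I × I) ≤ (y, y) from ⟨h, h⟩)).1

/-- **Separation**: two distinct points eventually lie in cells of different index. [this work] -/
theorem eventually_cellIdx_lt {x y : I} (h : x < y) : ∀ᶠ m : ℕ in atTop, cellIdx m x < cellIdx m y := by
  have ht : Tendsto (fun m : ℕ => (hiCorner m (cellPair m (x, x))).1) atTop (𝓝 x) :=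
    (continuous_fst.tendsto _).comp (tendsto_hiCorner_cellPair (x, x))
  filter_upwards [(tendsto_order.1 ht).2 y h] with m hm
  by_contra hle
  rw [not_lt] at hle
  have h1 : y ≤ (hiCorner m (cellPair m (y, y))).1 := (le_hiCorner (m := m) (y, y)).1
  have h2 : hiCorner m (cellPair m (y, y)) ≤ hiCorner m (cellPair m (x, x)) := monotone_hiCorner m ⟨hle, hle⟩
  exact lt_irrefl y (lt_of_le_of_lt (h1.trans h2.1) hm)

/-- Eventually, comparing cell indices is comparing points (`≤`, point on the right). [this work] -/
theorem eventually_cellIdx_le_iff (a x : I) : ∀ᶠ m : ℕ in atTop, (cellIdx m a ≤ cellIdx m x ↔ a ≤ x) := by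
  rcases le_or_gt a x with h | h
  · exact Eventually.of_forall fun m => iff_of_true (cellIdx_le_cellIdx h) h
  · filter_upwards [eventually_cellIdx_lt h] with m hm using iff_of_false (not_le.2 hm) (not_le.2 h)

/-- Eventually, comparing cell indices is comparing points (`<`). [this work] -/
theorem eventually_cellIdx_lt_iff (x c : I) : ∀ᶠ m : ℕ in atTop, (cellIdx m x < cellIdx m c ↔ x < c) := by
  rcases lt_or_ge x c with h | h
  · filter_upwards [eventually_cellIdx_lt h] with m hm using iff_of_true hm h
  · exact Eventually.of_forall fun m => iff_of_false (not_lt.2 (cellIdx_le_cellIdx h)) (not_lt.2 h)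

/-- **Convergence of the cell approximations**: if the index sets `K m` pick out the lower set `T` in the limit
(`cellIdx m y ∈ K m ↔ y ∈ T` eventually, for every `y`), then
`μ(block [cellIdx a, cellIdx b] × K m) → μ([a,b] × T)`. [this work] -/
theorem tendsto_measure_cellBlock (μ : Measure (I × I)) [IsFiniteMeasure μ] (a b : I) {T : Set I}
    (K : ∀ m : ℕ, Finset (Fin (m + 1)))
    (hKT : ∀ y : I, ∀ᶠ m : ℕ in atTop, (cellIdx m y ∈ K m ↔ y ∈ T)) :
    Tendsto (fun m : ℕ => μ (cellPair m ⁻¹' ↑(Finset.Icc (cellIdx m a) (cellIdx m b) ×ˢ K m))) atTop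
      (𝓝 (μ (Icc a b ×ˢ T))) := by
  refine tendsto_measure_of_tendsto_indicator atTop (fun m => measurableSet_cellBlock _ _) MeasurableSet.univ
    (measure_ne_top μ _) (Eventually.of_forall fun m => subset_univ _) fun p => ?_
  filter_upwards [eventually_cellIdx_le_iff a p.1, (eventually_cellIdx_le_iff p.1 b), hKT p.2] with m h1 h2 h3
  rw [mem_cellBlock, Finset.mem_Icc, mem_prod, mem_Icc, h1, h2, h3]

/-! ## Cell-FKG laws are TP₂ across cuts -/

/-- **Core of the limit argument.** For a cell-FKG probability measure, closed intervals `[a₁,b₁] < [a₂,b₂]` and a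
measurable set `T ⊆ [0,1]` picked out in the limit by LOWER index sets `K m`, the cut inequality
`μ([a₁,b₁] × Tᶜ) μ([a₂,b₂] × T) ≤ μ([a₁,b₁] × T) μ([a₂,b₂] × Tᶜ)` holds. [this work] -/
theorem measure_prod_mul_le_of_cellFKG (μ : Measure (I × I)) [IsFiniteMeasure μ]
    (hFKG : ∀ m, IsFKGMeasure (cellWeight μ m)) {a₁ b₁ a₂ b₂ : I} (hlt : b₁ < a₂) {T : Set I}
    (K : ∀ m : ℕ, Finset (Fin (m + 1)))
    (hK : ∀ m, ∀ j ∈ K m, ∀ j', j' ≤ j → j' ∈ K m)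
    (hKT : ∀ y : I, ∀ᶠ m : ℕ in atTop, (cellIdx m y ∈ K m ↔ y ∈ T)) :
    μ (Icc a₁ b₁ ×ˢ Tᶜ) * μ (Icc a₂ b₂ ×ˢ T) ≤ μ (Icc a₁ b₁ ×ˢ T) * μ (Icc a₂ b₂ ×ˢ Tᶜ) := by
  have hKT' : ∀ y : I, ∀ᶠ m : ℕ in atTop, (cellIdx m y ∈ (K m)ᶜ ↔ y ∈ Tᶜ) := fun y => by
    filter_upwards [hKT y] with m hm
    rw [Finset.mem_compl, mem_compl_iff, hm]
  have t₁ := tendsto_measure_cellBlock μ a₁ b₁ K hKT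
  have t₁' := tendsto_measure_cellBlock μ a₁ b₁ (fun m => (K m)ᶜ) hKT'
  have t₂ := tendsto_measure_cellBlock μ a₂ b₂ K hKT
  have t₂' := tendsto_measure_cellBlock μ a₂ b₂ (fun m => (K m)ᶜ) hKT'
  refine le_of_tendsto_of_tendsto'
    (ENNReal.Tendsto.mul t₁' (Or.inr (measure_ne_top _ _)) t₂ (Or.inr (measure_ne_top _ _)))
    (ENNReal.Tendsto.mul t₁ (Or.inr (measure_ne_top _ _)) t₂' (Or.inr (measure_ne_top _ _))) fun m => ?_
  refine measure_cellBlock_mul_le μ (hFKG m) _ _ (K m) (K m)ᶜ (fun i hi i' hi' => ?_) fun j hj j' hj' => ?_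
  · exact ((Finset.mem_Icc.1 hi).2.trans (cellIdx_le_cellIdx hlt.le)).trans (Finset.mem_Icc.1 hi').1
  · by_contra h
    exact (Finset.mem_compl.1 hj') (hK m j hj j' (not_le.1 h).le)

/-- In a complete linear order a lower set is `Iic (sup L)` or `Iio (sup L)`. [folklore] -/
theorem IsLowerSet.eq_Iic_or_eq_Iio {α : Type*} [CompleteLinearOrder α] {L : Set α} (hL : IsLowerSet L) :
    L = Iic (sSup L) ∨ L = Iio (sSup L) := by
  by_cases hc : sSup L ∈ L
  · exact Or.inl (Subset.antisymm (fun x hx => le_sSup hx) fun x hx => hL hx hc)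
  · refine Or.inr (Subset.antisymm (fun x hx => lt_of_le_of_ne (le_sSup hx) fun h => hc (h ▸ hx)) fun x hx => ?_)
    obtain ⟨y, hy, hxy⟩ := lt_sSup_iff.1 (mem_Iio.1 hx)
    exact hL hxy.le hy

/-- **Every cell-FKG probability measure on the unit square is TP₂ across cuts.** [this work] -/
theorem isTP2Cut_of_isFKGMeasure_cellWeight (μ : Measure (I × I)) [IsFiniteMeasure μ]
    (hFKG : ∀ m, IsFKGMeasure (cellWeight μ m)) : IsTP2Cut μ := by
  intro a₁ b₁ a₂ b₂ hlt L hL _hLm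
  rcases IsLowerSet.eq_Iic_or_eq_Iio hL with hL' | hL'
  · rw [hL']
    refine measure_prod_mul_le_of_cellFKG μ hFKG hlt (fun m => Finset.Iic (cellIdx m (sSup L)))
      (fun m j hj j' hj' => Finset.mem_Iic.2 (hj'.trans (Finset.mem_Iic.1 hj))) fun y => ?_
    filter_upwards [eventually_cellIdx_le_iff y (sSup L)] with m hm
    rw [Finset.mem_Iic, mem_Iic, hm]
  · rw [hL']
    refine measure_prod_mul_le_of_cellFKG μ hFKG hlt (fun m => Finset.Iio (cellIdx m (sSup L)))
      (fun m j hj j' hj' => Finset.mem_Iio.2 (hj'.trans_lt (Finset.mem_Iio.1 hj))) fun y => ?_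
    filter_upwards [eventually_cellIdx_lt_iff y (sSup L)] with m hm
    rw [Finset.mem_Iio, mem_Iio, hm]

/-! ## Sahi positivity of every order for every cell-FKG law, no semicontinuity -/

/-- **Every cell-FKG probability measure on `[0,1]²` is Sahi-positive of every order** — `E_n(f_0,…,f_{n-1}) ≥ 0` for
ALL measurable nonnegative monotone (increasing) families; compare `SahiTwoDimSemicontinuous.msahiE_nonneg_of_semicontinuous`
(generation 6), whose semicontinuity hypothesis is hereby removed (measurability of the family is assumed instead).
[this work] [cite: LiebSahi2021, Thm. 3.7] (the Lebesgue case behind the standard construction) -/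
theorem msahiE_nonneg_of_isFKGMeasure_cellWeight (μ : Measure (I × I)) [IsProbabilityMeasure μ]
    (hFKG : ∀ m, IsFKGMeasure (cellWeight μ m)) (n : ℕ) (f : Fin n → I × I → ℝ) (hfm : ∀ i, Measurable (f i))
    (hf0 : ∀ i p, 0 ≤ f i p) (hmono : ∀ i, Monotone (f i)) : 0 ≤ msahiE μ n f :=
  msahiE_nonneg_of_isTP2Cut_unitSquare μ (isTP2Cut_of_isFKGMeasure_cellWeight μ hFKG) n f hfm hf0 hmono

/-- The decreasing form: every cell-FKG probability measure on `[0,1]²` has `E_n ≥ 0` for all measurable nonnegative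
monotone decreasing families. [this work] -/
theorem msahiE_nonneg_of_isFKGMeasure_cellWeight_antitone (μ : Measure (I × I)) [IsProbabilityMeasure μ]
    (hFKG : ∀ m, IsFKGMeasure (cellWeight μ m)) (n : ℕ) (f : Fin n → I × I → ℝ) (hfm : ∀ i, Measurable (f i))
    (hf0 : ∀ i p, 0 ≤ f i p) (hanti : ∀ i, Antitone (f i)) : 0 ≤ msahiE μ n f :=
  msahiE_nonneg_of_isTP2Cut_unitSquare_antitone μ (isTP2Cut_of_isFKGMeasure_cellWeight μ hFKG) n f hfm hf0 hanti

end Summit.CriticalPhenomena.PercolationContinuityZ3.Theorems.SahiTP2
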